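import Literature.MathematicalPhysics.QuantumFieldTheory.Balaban1983to89.B7Eq92Concrete

/-!
# Bałaban's renormalization group for 4-d lattice Yang–Mills — B7 Sect. C AT AN ARBITRARY BACKGROUND, second half:
the SITE average (78) `{g(x)}_{x∈B(y)}` and its LEFT-INVARIANCE, the rotated site functions `(R_{0,y}v)(x)` (p. 27),
the twisted site average `(R̄₀v)(y)` (78), (60) ⇒ (82), the recursively defined BLOCK AVERAGES (85)
`\overline{R_{0,x}U₁^{(j)}}`, the identity (99)/(100) `\overline{R_{0,x}U₁^{(j)}} = v_j(x)` for every `j`, hence the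
FUNDAMENTAL EQUALITY (92) PROPER for every `k`, and (87) ⇒ (88) `= U̿₁^k` — as identities of the formal objects of
`B7Eq92Concrete` (no smallness, no unitarity) (`B7Eq99Concrete`)

CITATION HEADER (lean-in-tree rule 2026-08-18).  Audit cell `pub-balaban`, paper sub-cell B07 (unit b2b-balaban-b07,
gen 19, tertiary leaf).  Source: T. Bałaban, *Averaging operations for lattice gauge theories*, Commun. Math. Phys.
**98**, 17–51 (1985) [Balaban1985Averaging] (cell paper B7; journal page = PDF page + 16), Sect. B p. 27 [PDF 11]
(the display after (59), (60)), Sect. C p. 30 [14] ((78), (82)), p. 31 [15] ((85)–(88), (92)) and p. 32 [16] ((97),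
(99), (100)), quoted from the page renders `b2b-balaban-ref1/pages/1985-cmp98-averaging/1985-cmp98-averaging-p011-x2.png`,
`-p014-x2.png`, `-p015-x2.png`, `-p016-x2.png` READ AS IMAGES (2026-08-19, this unit; p015/p016 re-read for this file).
Companions (REUSED BY NAME, none modified): `B7Eq92Concrete` (this unit: `Rc` (56), `mgauge` (55), `tHol` (58) with the
transporter covariance `tHol_mgauge`, `Fcov`/`wframe` (82), `tild`/`tildIter` (65)/(69), `dbavgCov`/`dbavgCovIter`
(89)–(91), `vcov` (97), the fundamental equality (97) `tildIter_eq_mgauge`, (70)/(71) `tildIter_mgauge`),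
`B7Prop6Flat` (`vprod` (160)), `B7Prop2Explicit` (`avgIter` (43)), `B7Prop1Explicit` (`hol`, `treeWord`, `boxVec`,
`expUnit`), `B7AvgGaugeCovariance` (`uLev`), `MatrixLog` (`mlog` = the series (21)), `B8Ineq130` (`hol_one`), and
`B7Transfer` (b07 gens 2–3: the abstract `step99`/`sectC_induction_step`, whose binders `hT` (transporter covariance)
and `hb` (left-invariance of the site average) are DISCHARGED here for B7's own objects: `tHol_mgauge`
(`B7Eq92Concrete`) and `savg_const_mul`/`hb_concrete`).

THE PRINTED TEXT (verbatim from the renders).  p. 27: "(R_{0,y}V′)(Γ_{y,x}) = v(y)(R_{0,y}V₁)(Γ_{y,x})(R_{0,y}v)⁻¹(x)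
= 1, (R_{0,y}v)(x) = R(V₀(Γ_{y,x}))v(x), and they imply (R_{0,y}v)(x) = v(y)(R_{0,y}V₁)(Γ_{y,x}), x ∈ B(y), x ≠ y,
y ∈ Ω′^{(1)}. (60)"  p. 30: "Generally a one-step averaging transformation defined by a field configuration V₀ is
given by (R̄₀v)(y) = (\overline{R(V₀)v})(y) = {(R(V₀)v)(x)}_{x∈B(y)} = v(y)exp[iΣ_{x∈B(y)}L^{−d}(1/i) log
v⁻¹(y)R(V₀(Γ_{y,x}))v(x)], (78)"; "(R̄₀u)(x₁) = u(x₁)(\overline{R_{0,x₁}U₁})(Γ_{x₁,·}) = u(x₁)\overline{R_{0,x₁}U₁}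
(82) for x₁ ∈ Ω^{(1)}, where the expression \overline{R_{0,x₁}U₁} is defined by the last equation."  p. 31:
"\overline{R_{0,x_{j+1}}U₁^{(j+1)}} = {(R̄^j_{0,x_{j+1}}Ũ₁^j)(Γ_{x_{j+1},x_j})(R̄^j_{0,x_{j+1}}\overline{R_{0,x_j}U₁^{(j)}})(x_j)}_{x_j∈B(x_{j+1})},
x_{j+1} ∈ Ω^{(j+1)}. (85) The formula (84) together with the conditions (81) give the equation (R̄₀u^k)(y) =
u(y)\overline{R_{0,y}U₁^{(k)}} = 1 for y ∈ Ω^{(k)}, (86) hence u(y) = (\overline{R_{0,y}U₁^{(k)}})⁻¹. (87) Thus the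
gauge transformation is uniquely determined by all the conditions and is given by the formulas (77) for j = k − 1
and by (87). Similarly as in (63) we get Ū^k_b(Ū₀^k)_b⁻¹ = (\overline{U′U₀}^k)_b(Ū₀^k)_b⁻¹ =
u(b₋)(\overline{U₁U₀}^k)_b(Ū₀^k)_b⁻¹R̄^k_{0,b}u⁻¹(b₊) = (\overline{R_{0,b₋}U₁^{(k)}})⁻¹Ũ₁^kR̄^k_{0,b}\overline{R_{0,b₊}U₁^{(k)}},
b ⊂ Ω^{(k)}. (88) We may consider this expression as a new averaging operation of k^{th} order acting on a
configuration U₁ defined at bonds of the lattice Ω. […] We are going to prove now the fundamental equality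
(\overline{R_{0,b₋}U₁^{(k)}})⁻¹Ũ₁^kR̄^k_{0,b}\overline{R_{0,b₊}U₁^{(k)}} = (U̿₁^k)_b. (92)"  p. 32: "Let us make the
following inductive hypothesis: (Ũ₁^j)_b = v_j(b₋)(U̿₁^j)_bR̄^j_{0,b}v_j⁻¹(b₊) = (U̿₁^j)^{v_j}_b, b ⊂ Ω^{(j)}, v_j(x) =
(\overline{R_{0,x}U₁})(\overline{R̄_{0,x}U̿₁})·…·(\overline{R̄^{j−1}_{0,x}U̿₁^{j−1}}), x ∈ Ω^{(j)}. (97) We have proved it for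
j = 1, 2."; "Let us now consider the expressions \overline{R_{0,x}U₁^{(j)}}, x ∈ Ω^{(j)}. We will prove that
\overline{R_{0,x}U₁^{(j)}} = v_j(x), x ∈ Ω^{(j)}. (99) For j = 1 it is the definition (97) of v_j. For j + 1 we have by
(85), (97), and (99) \overline{R_{0,y}U₁^{(j+1)}} = {(R̄^j_{0,y}Ũ₁^j)(Γ_{y,x})(R̄^j_{0,y}\overline{R_{0,x}U₁^{(j)}})(x)}_{x∈B(y)}
= {(R̄^j_{0,y}(U̿₁^j)^{v_j})(Γ_{y,x})(R̄^j_{0,y}v_j)(x)}_{x∈B(y)} = v_j(y)(\overline{R̄^j_{0,y}U̿₁^j}) = v_{j+1}(y),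
y ∈ Ω^{(j+1)}, (100) hence the identity (99) is proved by induction. From (97), (99) for j = k we get (92)."

DICTIONARY print ↦ Lean (conventions of `B7Eq92Concrete`: every `Ω^{(j)} ≅ ℤ^d` by `rescale`, the block `B(y) =
y + [0, L)^d` (`boxVec`), `Γ_{y,x} = treeWord (x − y)` from `y`, bond values and frames in the units `𝔸ˣ` of a complete
normed `ℂ`-algebra, `log` = the series (21) `mlog`, print's `i·(1/i) = 1` cancelled).  The curly-brace SITE average of
(78), `{g(x)}_{x∈B(y)} = g(y)exp[Σ_{x∈B(y)}L^{−d} log g(y)⁻¹g(x)]` ↦ `savg L g y` (exponent `Sexp L g y`); the rotated site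
function `(R_{0,y}v)(x) = R(V₀(Γ_{y,x}))v(x)` (p. 27) ↦ `R0fun V₀ y v x` (§1, over any group); the twisted site average
`(R̄₀v)(y) = {(R_{0,y}v)(x)}_{x∈B(y)}` (78) ↦ `R0avg L V₀ v y`; the block averages (85) `w_j(x) = \overline{R_{0,x}U₁^{(j)}}`
↦ `wrec L U₀ U₁ j` (recursion (85) read literally: the site average over the block of level-`j` sites `x` around
`y = Lz ∈ Ω^{(j+1)}` of `(R̄^j_{0,y}Ũ₁^j)(Γ_{y,x})·(R̄^j_{0,y}w_j)(x)` = `tHol (avgIter L U₀ j) (tildIter L U₀ U₁ j) y Γ *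
R0fun (avgIter L U₀ j) y (wrec … j) x`, then rescaled to `z`; BASE `w_0 := 1`, which makes `w_1` the frame (82)
`\overline{R_{0,·}U₁}` — `wrec_one`); `v_j` of (97) ↦ `vcov` (`B7Eq92Concrete`); `u` read at level `k` ↦ `uLev L u k`.

WHAT THIS FILE PROVES (kernel, no `sorry`, standard axioms; NO hypotheses except the explicitly displayed `h60` /
`h87` in the three conditional statements `R0avg_of_60`, `eq88_of_87`, `avgIter_eq_of_87`; the `hg : g y = 1` of
`savg_of_center_eq_one` is a data condition): §1 `R0fun_self` (`(R_{0,y}v)(y) = v(y)`), `R0fun_one_left`,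
`tHol_mgauge_mul_R0fun` (the pointwise identity of (100): `(R_{0,y}W^v)(Γ_{y,x})·(R_{0,y}v)(x) = v(y)(R_{0,y}W)(Γ_{y,x})`);
§2 `val_savg` ((78) literally), `Sexp_const_mul`, `savg_const_mul` = LEFT-INVARIANCE `{a·g(x)}_{x∈B(y)} = a·{g(x)}_{x∈B(y)}`
for every constant unit `a` (`hb_concrete` = the binder `hb` of `B7Transfer.step99` literally), `savg_const`,
`savg_of_center_eq_one`, `savg_tHol` ((82): the site average of `x ↦ (R_{0,y}V₁)(Γ_{y,x})` is the frame `wframe`),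
`val_R0avg` ((78) literally), `R0avg_one_left`, `R0avg_of_60` ((60) on the block ⇒ (82) `(R̄₀u)(y) = u(y)\overline{R_{0,y}U₁}`);
§3 `wrec_one` ((85) at `j = 0` is (82)), `wrec_eq_vcov` = (99) `w_j = v_j` FOR EVERY `j` by print's induction (100)
(inputs exactly (97) `tildIter_eq_mgauge`, the transporter covariance and the left-invariance — the printed proof),
`step100` (the one-step form of (100) for ANY frame and configuration), `eq92` = THE FUNDAMENTAL EQUALITY (92) with the
frames the block averages (85), for every `k`, bondwise, `tildIter_eq_mgauge_wrec` (`Ũ₁^k = (U̿₁^k)^{w_k}`), `eq88_of_87`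
((87) ⇒ `(\overline{U′U₀})^k(Ū₀^k)⁻¹ = U̿₁^k` for `U′ = U₁^u`), `avgIter_eq_of_87` (`(\overline{U′U₀})^k = U̿₁^k·Ū₀^k`),
`wrec_one_left` (at `U₀ = 1`, `w_j = vprod`), and the `j = 1, 2` instances.

ABSOLUTE-RULE LEDGER.  No Literature `Prop`-fact, no `B7.Prop*` placeholder, nothing of the manuscript cited as a
fact; `h60` and `h87` are displayed hypotheses of the three conditional identities `R0avg_of_60`, `eq88_of_87`,
`avgIter_eq_of_87` (the printed CONCLUSIONS (60), (87) of the gauge fixing, whose derivations are not formalised in this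
file), never discharged by citation; `hg` (`savg_of_center_eq_one`) is a data condition.

NOT CERTIFIED HERE (located).  (i) The gauge fixing itself: the axial conditions (58) "= 1", the averaging conditions
(61)/(81), the formulas (62), (77), (79)–(80), (83)–(84), and (86) as a consequence of (81)/(84) — only (60) ⇒ (82) and
(87) ⇒ (88) are proved, with (60), (87) as hypotheses ((86) ⇒ (87) is `eq_inv_of_mul_eq_one_left` of Mathlib).
(ii) (63)/(64), (66)/(67), (72)–(76).  (iii) The locality remark p. 31.  (iv) Every estimate (curved Props. 3–7).

DIVERGENCES from print (cell DIVERGENCE.md D-b07g19.5).  (a) As `B7Eq92Concrete` (a): `ℤ^d`, units of a complete normed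
`ℂ`-algebra, ALL unit-valued configurations and site functions, no (52)/smallness, no unitarity — (99)/(100) and (92)
hold as formal identities.  (b) The block averages (85) are started at `j = 0` with `w_0 := 1` (print starts at (82),
`j = 1`; `wrec_one` shows the two agree).  (c) The site average (78) is defined for site functions on the whole fine
lattice and evaluated at the block points `y + r`, `r ∈ [0, L)^d`; no domain condition on the logarithm (series (21),
junk values off its convergence set, identities unaffected).

FINDINGS (cell GAPS.md C-b07g19-3).  Sect. C's second induction (99)/(100) and the fundamental equality (92) with the
recursively defined block averages (85) are correct as printed, as formal identities for B7's own averages; together with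
`B7Eq92Concrete` the whole algebraic content of Sect. C ((89)–(100), and (88) given (87)) is kernel-checked at an
arbitrary background, and all three binders `hcov`, `hT`, `hb` of the abstract `B7Transfer` skeleton are discharged for
the concrete objects.  No gap located.  VALUE = kernel certificates of the paper's own identities; NOT summit progress.

VERSIONS.  v1 (gen 19, p190824, commit df23a6115332): this file.  v1.0.1 (gen 19): DOCSTRING-ONLY wording fix after the
FULL cross-read of pv04-g19 (journal l.56883, verdict ok CONSISTENT, ABSOLUTE-RULE 0, printed text 12/12, dictionary 4/4,
statements 5/5, kernel 0, DOCFIX 1 LOW): D1 the header's "two conditional statements / identities" named only `h60`, `h87`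
— THREE theorems carry them (`R0avg_of_60`, `eq88_of_87`, `avgIter_eq_of_87`) and `savg_of_center_eq_one` carries the data
condition `hg`; both sentences reworded.  No declaration, statement or proof changed.
-/

noncomputable section

open NormedSpace Finset

namespace Literature.MathematicalPhysics.QuantumFieldTheory.Balaban1983to89.B7Eq99Concrete

open B7Prop1Explicit B7Prop2Explicit B7Prop3Flat B7Prop4Flat MatrixLog B7AvgGaugeCovariance B7Prop6Flat
open B7Eq92Concrete

-- `Site` alone would resolve to the torus sites of `Setup.lean`; re-export the `ℤ^d` sites of `B7Prop1Explicit`.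
export B7Prop1Explicit (Site)

variable {d : ℕ}

/-! ## §1 The rotated site functions `(R_{0,y}v)(x) = R(V₀(Γ_{y,x}))v(x)` (p. 27) over a group -/

section Rotated

variable {G : Type*} [Group G]

/-- **p. 27, the display after (59)**: "(R_{0,y}v)(x) = R(V₀(Γ_{y,x}))v(x)" — the site function `v` rotated to the
centre `y` along the tree contour `Γ_{y,x}` (`treeWord (x − y)` from `y`) by the background transporter.
[cite: Balaban1985Averaging, p.27 (display after (59))] -/
def R0fun (V₀ : Site d → Fin d → G) (y : Site d) (v : Site d → G) : Site d → G :=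
  fun x => Rc (hol V₀ y (treeWord (x - y))) (v x)

/-- `R0fun_apply`: unfolding. [cite: Balaban1985Averaging, p.27 (display after (59))] -/
@[simp] theorem R0fun_apply (V₀ : Site d → Fin d → G) (y : Site d) (v : Site d → G) (x : Site d) :
    R0fun V₀ y v x = Rc (hol V₀ y (treeWord (x - y))) (v x) := rfl

/-- At the centre the rotation is trivial: `(R_{0,y}v)(y) = v(y)` (`Γ_{y,y}` is the empty contour).
[cite: Balaban1985Averaging, p.27 (display after (59))] -/
@[simp] theorem R0fun_self (V₀ : Site d → Fin d → G) (y : Site d) (v : Site d → G) : R0fun V₀ y v y = v y := by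
  simp [R0fun]

/-- At the block point `x = y + r`: `(R_{0,y}v)(y + r) = R(V₀(Γ_r))v(y + r)` with `Γ_r = treeWord r` from `y`.
[cite: Balaban1985Averaging, p.27 (display after (59))] -/
theorem R0fun_add (V₀ : Site d → Fin d → G) (y : Site d) (v : Site d → G) (r : Site d) :
    R0fun V₀ y v (y + r) = Rc (hol V₀ y (treeWord r)) (v (y + r)) := by
  simp [R0fun]

/-- `R0fun_one_left`: at `V₀ = 1` there is no rotation, `(R_{0,y}v)(x) = v(x)`. [cite: Balaban1985Averaging, p.27, p.34] -/
@[simp] theorem R0fun_one_left (y : Site d) (v : Site d → G) : R0fun (1 : Site d → Fin d → G) y v = v := by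
  funext x
  simp [R0fun, B8Ineq130.hol_one]

/-- **(100), middle step** (p. 32): along the block, the (85)-integrand built from `Ũ = (U̿)^v` (the inductive hypothesis
(97)) and the rotated frame `(R̄_{0,y}v)(x)` collapses to `v(y)·(R̄_{0,y}U̿)(Γ_{y,x})` — print:
"{(R̄^j_{0,y}(U̿₁^j)^{v_j})(Γ_{y,x})(R̄^j_{0,y}v_j)(x)}_{x∈B(y)} = v_j(y)(\overline{R̄^j_{0,y}U̿₁^j})"; this is the pointwise identity
behind it (transporter covariance `tHol_mgauge` and `R(X)R(X)⁻¹ = 1`). [cite: Balaban1985Averaging, (100) p.32, (97) p.32] -/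
theorem tHol_mgauge_mul_R0fun (V₀ W : Site d → Fin d → G) (v : Site d → G) (y x : Site d) :
    tHol V₀ (mgauge V₀ v W) y (treeWord (x - y)) * R0fun V₀ y v x = v y * tHol V₀ W y (treeWord (x - y)) := by
  rw [tHol_mgauge, R0fun_apply, disp_treeWord, add_sub_cancel]
  group

end Rotated

/-! ## §2 The site average (78) `{g(x)}_{x∈B(y)}`, its left-invariance (B7Transfer's `hb`), the twisted site average
`(R̄₀v)(y)`, and (82) from the axial condition (60) -/

section SiteAverage

variable {𝔸 : Type*} [NormedRing 𝔸] [NormedAlgebra ℂ 𝔸] [CompleteSpace 𝔸]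

omit [NormedAlgebra ℂ 𝔸] [CompleteSpace 𝔸] in
/-- Bookkeeping: `(a·g(y))⁻¹·(a·g(x)) = g(y)⁻¹g(x)` — a constant left factor drops out of the relative values. [folklore] -/
theorem inv_mul_const_mul (a p q : 𝔸ˣ) : (a * p)⁻¹ * (a * q) = p⁻¹ * q := by
  rw [mul_inv_rev, mul_assoc, inv_mul_cancel_left]

omit [CompleteSpace 𝔸] in
/-- **The exponent of the site average (78)**: `S_g(y) := Σ_{x∈B(y)} L^{−d} log g(y)⁻¹g(x)` (`x = y + r`, `r ∈ [0,L)^d`;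
`log` = the series (21); print's `i·(1/i) = 1`). Print (78) p. 30: "(R̄₀v)(y) = (\overline{R(V₀)v})(y) = {(R(V₀)v)(x)}_{x∈B(y)}
= v(y)exp[iΣ_{x∈B(y)}L^{−d}(1/i) log v⁻¹(y)R(V₀(Γ_{y,x}))v(x)]", read as the definition of the curly-brace average
`{g(x)}_{x∈B(y)} = g(y)exp[Σ_{x∈B(y)}L^{−d} log g(y)⁻¹g(x)]` applied to `g = R(V₀)v = (R_{0,y}v)`. [cite: Balaban1985Averaging, (78) p.30] -/
def Sexp (L : ℕ) (g : Site d → 𝔸ˣ) (y : Site d) : 𝔸 :=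
  ∑ r : Fin d → Fin L, (((L : ℝ) ^ d)⁻¹) • mlog ((((g y)⁻¹ * g (y + boxVec L r) : 𝔸ˣ)) : 𝔸)

/-- **The site average (78)** `{g(x)}_{x∈B(y)} := g(y)·exp S_g(y)`, a unit of `𝔸`. [cite: Balaban1985Averaging, (78) p.30] -/
def savg (L : ℕ) (g : Site d → 𝔸ˣ) (y : Site d) : 𝔸ˣ := g y * expUnit (Sexp L g y)

omit [CompleteSpace 𝔸] in
/-- `Sexp_apply`: unfolding. [cite: Balaban1985Averaging, (78) p.30] -/
theorem Sexp_apply (L : ℕ) (g : Site d → 𝔸ˣ) (y : Site d) :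
    Sexp L g y = ∑ r : Fin d → Fin L, (((L : ℝ) ^ d)⁻¹) • mlog ((((g y)⁻¹ * g (y + boxVec L r) : 𝔸ˣ)) : 𝔸) := rfl

/-- `savg_apply`: unfolding. [cite: Balaban1985Averaging, (78) p.30] -/
theorem savg_apply (L : ℕ) (g : Site d → 𝔸ˣ) (y : Site d) : savg L g y = g y * expUnit (Sexp L g y) := rfl

/-- `val_savg`: (78) literally, `{g(x)}_{x∈B(y)} = g(y)exp[Σ_{x∈B(y)}L^{−d} log g(y)⁻¹g(x)]` in `𝔸`. [cite: Balaban1985Averaging, (78) p.30] -/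
theorem val_savg (L : ℕ) (g : Site d → 𝔸ˣ) (y : Site d) :
    (savg L g y : 𝔸) = (g y : 𝔸) * exp (∑ r : Fin d → Fin L, (((L : ℝ) ^ d)⁻¹) • mlog ((((g y)⁻¹ * g (y + boxVec L r) : 𝔸ˣ)) : 𝔸)) := by
  rfl

omit [CompleteSpace 𝔸] in
/-- The exponent sees only the relative values `g(y)⁻¹g(x)`: `S_{a·g} = S_g` for a constant unit `a`. [cite: Balaban1985Averaging, (78) p.30] -/
theorem Sexp_const_mul (L : ℕ) (a : 𝔸ˣ) (g : Site d → 𝔸ˣ) (y : Site d) :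
    Sexp L (fun x => a * g x) y = Sexp L g y := by
  simp only [Sexp, inv_mul_const_mul]

/-- **LEFT-INVARIANCE of the site average (78)** — `{a·g(x)}_{x∈B(y)} = a·{g(x)}_{x∈B(y)}` for every constant unit `a`
(the property `hb` that the abstract `B7Transfer.step99` takes as a binder; here a theorem for B7's own site average).
[cite: Balaban1985Averaging, (78) p.30, (100) p.32] -/
theorem savg_const_mul (L : ℕ) (a : 𝔸ˣ) (g : Site d → 𝔸ˣ) (y : Site d) :
    savg L (fun x => a * g x) y = a * savg L g y := by
  rw [savg_apply, savg_apply, Sexp_const_mul, mul_assoc]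

/-- `hb_concrete`: `savg L` satisfies the left-invariance binder `hb` of `B7Transfer.step99`/`sectC_induction_step`
literally. [cite: Balaban1985Averaging, (78) p.30] -/
theorem hb_concrete (L : ℕ) :
    ∀ (a : 𝔸ˣ) (g : Site d → 𝔸ˣ) (y : Site d), savg L (fun x => a * g x) y = a * savg L g y :=
  fun a g y => savg_const_mul L a g y

omit [CompleteSpace 𝔸] in
/-- A constant site function has exponent `0` (`log 1 = 0` for the series (21)). [cite: Balaban1985Averaging, (78) p.30, (21) p.21] -/
@[simp] theorem Sexp_const (L : ℕ) (a : 𝔸ˣ) (y : Site d) : Sexp L (fun _ : Site d => a) y = 0 := by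
  simp [Sexp, mlog_one]

/-- The site average (78) of a constant site function is that constant: `{a}_{x∈B(y)} = a`. [cite: Balaban1985Averaging, (78) p.30] -/
@[simp] theorem savg_const (L : ℕ) (a : 𝔸ˣ) (y : Site d) : savg L (fun _ : Site d => a) y = a := by
  rw [savg_apply, Sexp_const]
  apply Units.ext
  simp [val_expUnit]

/-- A site function that is `1` at the centre averages to `exp` of the plain `L^{−d}`-weighted sum of logarithms over the
block. [cite: Balaban1985Averaging, (78) p.30, (82) p.30] -/
theorem savg_of_center_eq_one (L : ℕ) (g : Site d → 𝔸ˣ) (y : Site d) (hg : g y = 1) :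
    savg L g y = expUnit (∑ r : Fin d → Fin L, (((L : ℝ) ^ d)⁻¹) • mlog ((g (y + boxVec L r) : 𝔸ˣ) : 𝔸)) := by
  rw [savg_apply, Sexp_apply, hg, one_mul]
  simp only [inv_one, one_mul]

/-- **(82), the block frame as a site average**: `\overline{R_{0,y}V₁} = {(R_{0,y}V₁)(Γ_{y,x})}_{x∈B(y)}` — the site average (78)
of the transporters `x ↦ (R_{0,y}V₁)(Γ_{y,x})` (which is `1` at `x = y`) is the frame `wframe` of `B7Eq92Concrete` ((82) p. 30:
"where the expression \overline{R_{0,x₁}U₁} is defined by the last equation"). [cite: Balaban1985Averaging, (82) p.30, (85) p.31] -/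
theorem savg_tHol (L : ℕ) (V₀ V₁ : Site d → Fin d → 𝔸ˣ) (y : Site d) :
    savg L (fun x => tHol V₀ V₁ y (treeWord (x - y))) y = wframe L V₀ V₁ y := by
  rw [savg_of_center_eq_one L _ y (by simp)]
  simp only [add_sub_cancel_left]
  rfl

/-- **(78), the twisted site average** `(R̄₀v)(y) := {(R_{0,y}v)(x)}_{x∈B(y)}` of a site function `v` at the background `V₀`.
[cite: Balaban1985Averaging, (78) p.30] -/
def R0avg (L : ℕ) (V₀ : Site d → Fin d → 𝔸ˣ) (v : Site d → 𝔸ˣ) (y : Site d) : 𝔸ˣ := savg L (R0fun V₀ y v) y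

/-- `val_R0avg` — (78) literally: "(R̄₀v)(y) = v(y)exp[Σ_{x∈B(y)}L^{−d} log v⁻¹(y)R(V₀(Γ_{y,x}))v(x)]" (`x = y + r`).
[cite: Balaban1985Averaging, (78) p.30] -/
theorem val_R0avg (L : ℕ) (V₀ : Site d → Fin d → 𝔸ˣ) (v : Site d → 𝔸ˣ) (y : Site d) :
    (R0avg L V₀ v y : 𝔸) = (v y : 𝔸) * exp (∑ r : Fin d → Fin L, (((L : ℝ) ^ d)⁻¹) •
      mlog ((((v y)⁻¹ * Rc (hol V₀ y (treeWord (boxVec L r))) (v (y + boxVec L r)) : 𝔸ˣ)) : 𝔸)) := by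
  rw [R0avg, val_savg, R0fun_self]
  simp only [R0fun_add]

/-- `R0avg_one_left`: at `V₀ = 1` the twisted site average is the plain one. [cite: Balaban1985Averaging, (78) p.30] -/
@[simp] theorem R0avg_one_left (L : ℕ) (v : Site d → 𝔸ˣ) (y : Site d) :
    R0avg L (1 : Site d → Fin d → 𝔸ˣ) v y = savg L v y := by
  rw [R0avg, R0fun_one_left]

/-- **(60) ⇒ (82)**: if the gauge function `u` satisfies the axial-gauge relation (60) at the block points `x = y + r`,
`r ∈ [0, L)^d` — "(R_{0,y}v)(x) = v(y)(R_{0,y}V₁)(Γ_{y,x}), x ∈ B(y), x ≠ y" (at `x = y` it holds trivially) —, then its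
twisted site average is (82) "(R̄₀u)(x₁) = u(x₁)(\overline{R_{0,x₁}U₁})(Γ_{x₁,·}) = u(x₁)\overline{R_{0,x₁}U₁}". The relation
(60) is the HYPOTHESIS `h60` (the gauge fixing (58) that produces it is not formalised). [cite: Balaban1985Averaging, (60) p.27, (82) p.30] -/
theorem R0avg_of_60 (L : ℕ) (V₀ V₁ : Site d → Fin d → 𝔸ˣ) (u : Site d → 𝔸ˣ) (y : Site d)
    (h60 : ∀ r : Fin d → Fin L, R0fun V₀ y u (y + boxVec L r) = u y * tHol V₀ V₁ y (treeWord (boxVec L r))) :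
    R0avg L V₀ u y = u y * wframe L V₀ V₁ y := by
  rw [R0avg, savg_apply, Sexp_apply, R0fun_self]
  simp only [h60, inv_mul_cancel_left]
  rfl

end SiteAverage

/-! ## §3 The block averages (85) `\overline{R_{0,x}U₁^{(j)}}`, the identity (99)/(100), and (92) proper -/

section BlockAverages

variable {𝔸 : Type*} [NormedRing 𝔸] [NormedAlgebra ℂ 𝔸] [CompleteSpace 𝔸]

/-- **(85)** p. 31, the recursively defined block averages `w_j(x) = \overline{R_{0,x}U₁^{(j)}}`, `x ∈ Ω^{(j)} ≅ ℤ^d`: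
"\overline{R_{0,x_{j+1}}U₁^{(j+1)}} = {(R̄^j_{0,x_{j+1}}Ũ₁^j)(Γ_{x_{j+1},x_j})(R̄^j_{0,x_{j+1}}\overline{R_{0,x_j}U₁^{(j)}})(x_j)}_{x_j∈B(x_{j+1})},
x_{j+1} ∈ Ω^{(j+1)}. (85)" — the site average (78), over the block `B(y)` of level-`j` sites (`y = Lz`), of the
`Ū₀^j`-twisted transports of `Ũ₁^j` (69) along `Γ_{y,x}` times the rotated previous averages; then rescaled to `z`. Base:
`w_0 := 1`, so that `w_1 = \overline{R_{0,·}U₁}` is (82) (`wrec_one`). [cite: Balaban1985Averaging, (85) p.31, (82) p.30] -/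
def wrec (L : ℕ) (U₀ U₁ : Site d → Fin d → 𝔸ˣ) : ℕ → Site d → 𝔸ˣ
  | 0 => fun _ => 1
  | j + 1 => fun z =>
      savg L (fun x => tHol (avgIter L U₀ j) (tildIter L U₀ U₁ j) ((L : ℤ) • z) (treeWord (x - (L : ℤ) • z))
        * R0fun (avgIter L U₀ j) ((L : ℤ) • z) (wrec L U₀ U₁ j) x) ((L : ℤ) • z)

/-- `wrec_zero`: `w_0 = 1`. [cite: Balaban1985Averaging, (85) p.31] -/
@[simp] theorem wrec_zero (L : ℕ) (U₀ U₁ : Site d → Fin d → 𝔸ˣ) (z : Site d) : wrec L U₀ U₁ 0 z = 1 := rfl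

/-- `wrec_succ`: (85) unfolded. [cite: Balaban1985Averaging, (85) p.31] -/
theorem wrec_succ (L : ℕ) (U₀ U₁ : Site d → Fin d → 𝔸ˣ) (j : ℕ) (z : Site d) :
    wrec L U₀ U₁ (j + 1) z
      = savg L (fun x => tHol (avgIter L U₀ j) (tildIter L U₀ U₁ j) ((L : ℤ) • z) (treeWord (x - (L : ℤ) • z))
          * R0fun (avgIter L U₀ j) ((L : ℤ) • z) (wrec L U₀ U₁ j) x) ((L : ℤ) • z) := rfl

/-- **(85) at `j = 0` is (82)**: `w_1(x₁) = \overline{R_{0,x₁}U₁}` (`Ũ₁^0 = U₁`, `Ū₀^0 = U₀`, `w_0 = 1`), the block frame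
`wframe L U₀ U₁` read on `Ω^{(1)}`. [cite: Balaban1985Averaging, (85) p.31, (82) p.30] -/
theorem wrec_one (L : ℕ) (U₀ U₁ : Site d → Fin d → 𝔸ˣ) (z : Site d) :
    wrec L U₀ U₁ 1 z = wframe L U₀ U₁ ((L : ℤ) • z) := by
  rw [wrec_succ, avgIter_zero, tildIter_zero']
  have h : (fun x => tHol U₀ U₁ ((L : ℤ) • z) (treeWord (x - (L : ℤ) • z))
      * R0fun U₀ ((L : ℤ) • z) (wrec L U₀ U₁ 0) x)
      = fun x => tHol U₀ U₁ ((L : ℤ) • z) (treeWord (x - (L : ℤ) • z)) := by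
    funext x
    simp only [wrec_zero, R0fun_apply, map_one, mul_one]
  rw [h, savg_tHol]

/-- **(99)/(100)** p. 32: "\overline{R_{0,x}U₁^{(j)}} = v_j(x), x ∈ Ω^{(j)}. (99) For j = 1 it is the definition (97) of v_j.
For j + 1 we have by (85), (97), and (99) \overline{R_{0,y}U₁^{(j+1)}} = {(R̄^j_{0,y}Ũ₁^j)(Γ_{y,x})(R̄^j_{0,y}\overline{R_{0,x}U₁^{(j)}})(x)}_{x∈B(y)}
= {(R̄^j_{0,y}(U̿₁^j)^{v_j})(Γ_{y,x})(R̄^j_{0,y}v_j)(x)}_{x∈B(y)} = v_j(y)(\overline{R̄^j_{0,y}U̿₁^j}) = v_{j+1}(y), y ∈ Ω^{(j+1)}, (100)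
hence the identity (99) is proved by induction." — the recursively defined block averages (85) ARE the accumulated
frames (97), for every `j` (here from `j = 0`, `w_0 = v_0 = 1`). Inputs, as printed: the fundamental equality (97)
(`B7Eq92Concrete.tildIter_eq_mgauge`), the transporter covariance (`tHol_mgauge`, via `tHol_mgauge_mul_R0fun`) and the
left-invariance of the site average (`savg_const_mul`). [cite: Balaban1985Averaging, (99) p.32, (100) p.32] -/
theorem wrec_eq_vcov (L : ℕ) (U₀ U₁ : Site d → Fin d → 𝔸ˣ) : ∀ j : ℕ, wrec L U₀ U₁ j = vcov L U₀ U₁ j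
  | 0 => rfl
  | j + 1 => by
    funext z
    rw [wrec_succ, wrec_eq_vcov L U₀ U₁ j, tildIter_eq_mgauge L U₀ U₁ j, vcov_succ]
    have h : (fun x => tHol (avgIter L U₀ j)
          (mgauge (avgIter L U₀ j) (vcov L U₀ U₁ j) (dbavgCovIter L U₀ U₁ j)) ((L : ℤ) • z)
          (treeWord (x - (L : ℤ) • z)) * R0fun (avgIter L U₀ j) ((L : ℤ) • z) (vcov L U₀ U₁ j) x)
        = fun x => vcov L U₀ U₁ j ((L : ℤ) • z)
          * tHol (avgIter L U₀ j) (dbavgCovIter L U₀ U₁ j) ((L : ℤ) • z) (treeWord (x - (L : ℤ) • z)) := by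
      funext x
      exact tHol_mgauge_mul_R0fun _ _ _ _ _
    rw [h, savg_const_mul, savg_tHol]

/-- **(100), last two equalities**, as the one-step statement: for ANY frame `v` and configuration `W` at the background `V₀`,
`{(R_{0,y}W^v)(Γ_{y,x})(R_{0,y}v)(x)}_{x∈B(y)} = v(y)·\overline{R_{0,y}W}` (the abstract `B7Transfer.step99` for B7's own
site average and transport, binders `hT`, `hb` discharged). [cite: Balaban1985Averaging, (100) p.32] -/
theorem step100 (L : ℕ) (V₀ W : Site d → Fin d → 𝔸ˣ) (v : Site d → 𝔸ˣ) (y : Site d) :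
    savg L (fun x => tHol V₀ (mgauge V₀ v W) y (treeWord (x - y)) * R0fun V₀ y v x) y = v y * wframe L V₀ W y := by
  have h : (fun x => tHol V₀ (mgauge V₀ v W) y (treeWord (x - y)) * R0fun V₀ y v x)
      = fun x => v y * tHol V₀ W y (treeWord (x - y)) := funext fun x => tHol_mgauge_mul_R0fun _ _ _ _ _
  rw [h, savg_const_mul, savg_tHol]

/-- **THE FUNDAMENTAL EQUALITY (92) PROPER** p. 31: "(\overline{R_{0,b₋}U₁^{(k)}})⁻¹Ũ₁^kR̄^k_{0,b}\overline{R_{0,b₊}U₁^{(k)}} = (U̿₁^k)_b. (92)"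
— with the frames the recursively defined BLOCK AVERAGES (85) (print p. 32: "From (97), (99) for j = k we get (92)"), for
every `k`, every `L`, all unit-valued `U₀`, `U₁`, at every bond `b = ⟨z, z + e_κ⟩` of `Ω^{(k)} ≅ ℤ^d`
(`R̄^k_{0,b} = R(Ū₀^k(b))`). [cite: Balaban1985Averaging, (92) p.31, (97) p.32, (99) p.32] -/
theorem eq92 (L : ℕ) (U₀ U₁ : Site d → Fin d → 𝔸ˣ) (k : ℕ) (z : Site d) (κ : Fin d) :
    (wrec L U₀ U₁ k z)⁻¹ * tildIter L U₀ U₁ k z κ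
        * Rc (avgIter L U₀ k z κ) (wrec L U₀ U₁ k (z + e κ))
      = dbavgCovIter L U₀ U₁ k z κ := by
  rw [wrec_eq_vcov, tildIter_eq_mgauge L U₀ U₁ k, mgauge_apply]
  group

/-- (92) in the gauge-action form: `Ũ₁^k = (U̿₁^k)^{w_k}` with `w_k = \overline{R_{0,·}U₁^{(k)}}` the block averages (85).
[cite: Balaban1985Averaging, (92) p.31, (99) p.32] -/
theorem tildIter_eq_mgauge_wrec (L : ℕ) (U₀ U₁ : Site d → Fin d → 𝔸ˣ) (k : ℕ) :
    tildIter L U₀ U₁ k = mgauge (avgIter L U₀ k) (wrec L U₀ U₁ k) (dbavgCovIter L U₀ U₁ k) := by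
  rw [wrec_eq_vcov, tildIter_eq_mgauge]

/-- **(87) ⇒ (88) = `U̿₁^k`** p. 31: "u(y) = (\overline{R_{0,y}U₁^{(k)}})⁻¹. (87) … Similarly as in (63) we get
Ū^k_b(Ū₀^k)_b⁻¹ = (\overline{U′U₀}^k)_b(Ū₀^k)_b⁻¹ = u(b₋)(\overline{U₁U₀}^k)_b(Ū₀^k)_b⁻¹R̄^k_{0,b}u⁻¹(b₊) =
(\overline{R_{0,b₋}U₁^{(k)}})⁻¹Ũ₁^kR̄^k_{0,b}\overline{R_{0,b₊}U₁^{(k)}}, b ⊂ Ω^{(k)}. (88)" combined with (92): for the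
gauge-fixed field `U′ = U₁^u` (moving frame (55) at `U₀`), IF the gauge function read at level `k` (`u_k(z) = u(L^kz)`,
`uLev`) is given by (87) — the HYPOTHESIS `h87`; the gauge-fixing conditions (81)/(84)/(86) producing it are not
formalised — then `(\overline{U′U₀})^k(Ū₀^k)⁻¹ = U̿₁^k` bondwise. The middle equality of (88) alone, for every `u`, is
`B7Eq92Concrete.tildIter_mgauge` ((70)/(71)). [cite: Balaban1985Averaging, (87) p.31, (88) p.31, (92) p.31] -/
theorem eq88_of_87 (L : ℕ) (U₀ U₁ : Site d → Fin d → 𝔸ˣ) (u : Site d → 𝔸ˣ) (k : ℕ)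
    (h87 : ∀ z : Site d, uLev L u k z = (wrec L U₀ U₁ k z)⁻¹) :
    tildIter L U₀ (mgauge U₀ u U₁) k = dbavgCovIter L U₀ U₁ k := by
  funext z κ
  rw [tildIter_mgauge, mgauge_apply, h87, h87, map_inv, inv_inv, tildIter_eq_mgauge_wrec, mgauge_apply]
  group

/-- (88)/(43) for the full average under (87): `(\overline{U′U₀})^k = U̿₁^k·Ū₀^k`, i.e. in the gauge (87) the `k`-fold
average of `U = U′U₀` is the double-bar average times the averaged background, with NO frame left over.
[cite: Balaban1985Averaging, (88) p.31, (43) p.23] -/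
theorem avgIter_eq_of_87 (L : ℕ) (U₀ U₁ : Site d → Fin d → 𝔸ˣ) (u : Site d → 𝔸ˣ) (k : ℕ)
    (h87 : ∀ z : Site d, uLev L u k z = (wrec L U₀ U₁ k z)⁻¹) :
    avgIter L (mgauge U₀ u U₁ * U₀) k = dbavgCovIter L U₀ U₁ k * avgIter L U₀ k := by
  have h := eq88_of_87 L U₀ U₁ u k h87
  funext z κ
  have hz := congrFun (congrFun h z) κ
  rw [tildIter_apply] at hz
  rw [Pi.mul_apply, Pi.mul_apply, ← hz, inv_mul_cancel_right]

/-! ### Flat reductions (`U₀ = 1`) -/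

/-- At `U₀ = 1` the block averages (85) are the flat accumulated frames (160) `B7Prop6Flat.vprod`.
[cite: Balaban1985Averaging, (85) p.31, (160) p.42] -/
theorem wrec_one_left (L : ℕ) (U₁ : Site d → Fin d → 𝔸ˣ) (j : ℕ) :
    wrec L (1 : Site d → Fin d → 𝔸ˣ) U₁ j = vprod L U₁ j := by
  rw [wrec_eq_vcov, vcov_one_left]

/-! ### Sanity instances: (99) at `j = 1, 2` ("We have proved it for j = 1, 2", p. 32) -/

/-- `j = 1`: `\overline{R_{0,x}U₁^{(1)}} = v_1(x) = \overline{R_{0,x}U₁}`. [cite: Balaban1985Averaging, (97) p.32, (99) p.32] -/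
example (L : ℕ) (U₀ U₁ : Site d → Fin d → 𝔸ˣ) (z : Site d) : wrec L U₀ U₁ 1 z = vcov L U₀ U₁ 1 z := by
  rw [wrec_eq_vcov]

/-- `j = 2`: `\overline{R_{0,x}U₁^{(2)}} = v_2(x) = (\overline{R_{0,x}U₁})(\overline{R̄_{0,x}U̿₁})` ((97) with two factors; (94)–(96)).
[cite: Balaban1985Averaging, (97) p.32, (96) p.32] -/
example (L : ℕ) (U₀ U₁ : Site d → Fin d → 𝔸ˣ) (z : Site d) :
    wrec L U₀ U₁ 2 z
      = wframe L U₀ U₁ ((L : ℤ) • (L : ℤ) • z) * wframe L (avgIter L U₀ 1) (dbavgCovIter L U₀ U₁ 1) ((L : ℤ) • z) := by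
  rw [wrec_eq_vcov, vcov_succ, vcov_succ, vcov_zero, one_mul, avgIter_zero, dbavgCovIter_zero]

end BlockAverages

end Literature.MathematicalPhysics.QuantumFieldTheory.Balaban1983to89.B7Eq99Concrete
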